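import Summits.QuantumFields.YangMills.Theorems.UnitScaleTiltFluctuationComparisonRegPrTwoCutoffOperatorHeightFree
import HarnessLib

/-!
# `UnitScaleTiltFluctuationComparisonRegPrTwoCutoffOperatorHeightFreeForm` — THE REFERENCE OPERATOR'S SYMBOL IS THE REFERENCE SYMBOL: the plane-wave form (4.35) of the
# height-free effective Laplacian `Δ^{(∞)}` on every unit torus, `|Ω|·⟨φ, Δ^{(∞)}φ⟩ = Σ_q Δ^{(∞)}(p′(q))·|φ̃(q)|²`, hypothesis-free
# (crux `FluctuationComparisonRegPrIntL`, stmt-QuantumFields-20520, STUB 3⁗χ; cell `pub/ym-inputs`, INPUT-LIST I-11 row p10; seat ym-inputs-p10, file 5, count-neutral helper, def-free)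

WHY.  Files 1–2 (✓ p618709, ✓ p619483) produced two height-free reference objects of the flat `A = 0` template — the limit SYMBOL `Δ^{(∞)}(p′)` (per zone momentum) and the limit
OPERATOR `Δ^{(∞)}` (per unit torus) — each as the `k → ∞` limit of King's actual level-`k` objects with the per-run rate `θ̄·L^{−2k}`.  This file records that they are ONE object:
the operator's quadratic form is diagonalised by the torus Fourier transform with the limit symbol as multiplier, i.e. King's (4.35) «`⟨f, Δ^{(k)}f⟩ = Σ_{p′} Δ^{(k)}(p′)|f̃(p′)|²`»
survives the limit (`tendsto_nhds_unique` on the tree's identity `effLaplacian_form_DeltaEff` for every `k ≥ 1`).  A definer of reference objects can therefore take EITHER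
description (spectral or matrix) — they agree by name.

* **`exists_heightFree_operator_form`**: for `a > 0`, `m² > 0`, `L ≥ 2` and every torus `Ω = Π ℤ∕M_μ` there are a matrix `Δ^{(∞)}` and a symbol `σ^{(∞)} : Ω̂ → [0, a]` with
  `Δ^{(k)}(z,w) → Δ^{(∞)}(z,w)`, `Δ^{(k)}(p′(q)) → σ^{(∞)}(q)` at the per-run relative rate `θ̄·L^{−2k}` (zero mode included), and `|Ω|·⟨φ, Δ^{(∞)}φ⟩ = Σ_q σ^{(∞)}(q)·‖φ̃(q)‖²`
  for every `φ`.

HONEST FRAMING.  Flat, abelian, `A = 0`, periodic b.c., `m² > 0`; assembled from files 1–2 and the tree's `King1986.Torus.effLaplacian_form_DeltaEff`; nothing of [Balaban1985UV3] ∕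
[King1986] asserted; not the non-abelian row (no carrier, unprinted); stub ∕ crux ∕ (α) record untouched; YM₃ on T³ is a rung, not Clay ∕ 𝕋⁴ ∕ mass gap; no summit statement here.

References: C. King, CMP 102 (1986) 649–677 [King1986] ((4.5) p.670, (4.35) p.674, Prop. 3.10 (3.91)–(3.92) p.669).
-/

set_option autoImplicit false

noncomputable section

open Filter Topology Real Finset Matrix
open scoped BigOperators
open Literature.MathematicalPhysics.QuantumFieldTheory.Balaban1983to89
open Literature.MathematicalPhysics.QuantumFieldTheory.Balaban1983to89.B5Prop11Plancherel
open Literature.MathematicalPhysics.QuantumFieldTheory.King1986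
open Literature.MathematicalPhysics.QuantumFieldTheory.King1986.Torus
open Summit.QuantumFields.YangMills.Theorems.TwoCutoffOperatorHeightFree

namespace Summit.QuantumFields.YangMills.Theorems.TwoCutoffOperatorHeightFreeForm

variable {d : ℕ}

/-- **THE PLANE-WAVE FORM OF THE HEIGHT-FREE REFERENCE OPERATOR.**  For `a > 0`, `m² > 0`, `L ≥ 2` and every torus `Ω = Π_μ ℤ∕M_μ` there are a real matrix `Δ^{(∞)}` on `Ω` and a
symbol `σ^{(∞)} : Ω̂ → ℝ` such that: (i) `Δ^{(k)}(z,w) → Δ^{(∞)}(z,w)` for King's `Δ^{(k)} = effLaplacian (L^k) M a_k L^{2k} m²`; (ii) `Δ^{(k)}(p′(q)) → σ^{(∞)}(q)` with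
`0 ≤ σ^{(∞)}(q) ≤ a` and (iii) `|Δ^{(k)}(p′(q)) − σ^{(∞)}(q)| ≤ θ̄·L^{−2k}·Δ^{(k)}(p′(q))` for every `k ≥ 1` and every mode `q` (zero mode included); (iv) **(4.35) in the limit**:
`|Ω|·⟨φ, Δ^{(∞)}φ⟩ = Σ_q σ^{(∞)}(q)·‖φ̃(q)‖²` for every `φ` — the reference operator is Fourier-diagonal with the reference symbol. [cite: King1986, (4.35) p.674, (4.5) p.670, Prop. 3.10 (3.91) p.669] -/
theorem exists_heightFree_operator_form {a m2 : ℝ} (ha : 0 < a) (hm : 0 < m2) {L : ℕ} [NeZero L] (hL : 2 ≤ L) (M : Fin d → ℕ) [∀ μ, NeZero (M μ)] :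
    ∃ (Δinf : Matrix (Tor M) (Tor M) ℝ) (σinf : Tor M → ℝ),
      (∀ z w, Tendsto (fun k : ℕ => effLaplacian (L ^ k) M (aK a L k) (((L ^ k : ℕ) : ℝ) ^ 2) m2 z w) atTop (𝓝 (Δinf z w))) ∧
      (∀ q, Tendsto (fun k : ℕ => DeltaEff (aK a L k) (L ^ k) m2 (sOf M q)) atTop (𝓝 (σinf q))) ∧
      (∀ q, 0 ≤ σinf q ∧ σinf q ≤ a) ∧
      (∀ k : ℕ, 1 ≤ k → ∀ q, |DeltaEff (aK a L k) (L ^ k) m2 (sOf M q) - σinf q| ≤ thetaBar a L * (((L : ℝ) ^ k) ^ 2)⁻¹ * DeltaEff (aK a L k) (L ^ k) m2 (sOf M q)) ∧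
      (∀ φ : Tor M → ℝ, (Fintype.card (Tor M) : ℝ) * (φ ⬝ᵥ (Δinf *ᵥ φ)) = ∑ q : Tor M, σinf q * ‖ft M φ q‖ ^ 2) := by
  have hL1 : (1 : ℝ) < L := by exact_mod_cast hL
  obtain ⟨Δinf, -, hent, -, hform, -, -⟩ := exists_heightFree_operator ha hm hL M
  have hsym : ∀ q : Tor M, ∃ x : ℝ, 0 ≤ x ∧ x ≤ a ∧ Tendsto (fun k : ℕ => DeltaEff (aK a L k) (L ^ k) m2 (sOf M q)) atTop (𝓝 x) ∧
      ∀ k : ℕ, 1 ≤ k → |DeltaEff (aK a L k) (L ^ k) m2 (sOf M q) - x| ≤ thetaBar a L * (((L : ℝ) ^ k) ^ 2)⁻¹ * DeltaEff (aK a L k) (L ^ k) m2 (sOf M q) :=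
    fun q => exists_heightFree_symbol ha hL hm (fun μ => abs_sOf_le M q μ)
  choose σ hσ0 hσa hσt hσr using hsym
  refine ⟨Δinf, σ, hent, hσt, fun q => ⟨hσ0 q, hσa q⟩, fun k hk q => hσr q k hk, fun φ => ?_⟩
  -- both sides are limits of the two sides of (4.35) at level `k`
  have hLHS : Tendsto (fun k : ℕ => (Fintype.card (Tor M) : ℝ) * (φ ⬝ᵥ (effLaplacian (L ^ k) M (aK a L k) (((L ^ k : ℕ) : ℝ) ^ 2) m2 *ᵥ φ))) atTop
      (𝓝 ((Fintype.card (Tor M) : ℝ) * (φ ⬝ᵥ (Δinf *ᵥ φ)))) := (hform φ).const_mul _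
  have hRHS : Tendsto (fun k : ℕ => ∑ q : Tor M, DeltaEff (aK a L k) (L ^ k) m2 (sOf M q) * ‖ft M φ q‖ ^ 2) atTop
      (𝓝 (∑ q : Tor M, σ q * ‖ft M φ q‖ ^ 2)) :=
    tendsto_finsetSum _ fun q _ => (hσt q).mul_const _
  refine tendsto_nhds_unique_of_eventuallyEq hLHS hRHS ?_
  filter_upwards [eventually_ge_atTop 1] with k hk
  exact effLaplacian_form_DeltaEff (L ^ k) M (Nat.one_le_pow k L (by omega)) (aK_pos ha hL1 hk) hm φ

/-- **CONSEQUENCE: the reference form is the limit of the level forms mode by mode, with the relative budget**: for every `φ` and `k ≥ 1`,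
`|Ω|·|⟨φ,Δ^{(k)}φ⟩ − ⟨φ,Δ^{(∞)}φ⟩| ≤ Σ_q |Δ^{(k)}(p′(q)) − σ^{(∞)}(q)|·‖φ̃(q)‖² ≤ θ̄·L^{−2k}·|Ω|·⟨φ,Δ^{(k)}φ⟩` — the spectral reading of file 2's clause (vi).
[cite: King1986, (3.92) p.669, (4.35) p.674] -/
theorem form_sub_reference_le_sum {a m2 : ℝ} (ha : 0 < a) (hm : 0 < m2) {L k : ℕ} [NeZero L] (hL : 2 ≤ L) (hk : 1 ≤ k) (M : Fin d → ℕ) [∀ μ, NeZero (M μ)]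
    {Δinf : Matrix (Tor M) (Tor M) ℝ} {σinf : Tor M → ℝ}
    (hf : ∀ φ : Tor M → ℝ, (Fintype.card (Tor M) : ℝ) * (φ ⬝ᵥ (Δinf *ᵥ φ)) = ∑ q : Tor M, σinf q * ‖ft M φ q‖ ^ 2) (φ : Tor M → ℝ) :
    (Fintype.card (Tor M) : ℝ) * |φ ⬝ᵥ (effLaplacian (L ^ k) M (aK a L k) (((L ^ k : ℕ) : ℝ) ^ 2) m2 *ᵥ φ) - φ ⬝ᵥ (Δinf *ᵥ φ)|
      ≤ ∑ q : Tor M, |DeltaEff (aK a L k) (L ^ k) m2 (sOf M q) - σinf q| * ‖ft M φ q‖ ^ 2 := by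
  have hL1 : (1 : ℝ) < L := by exact_mod_cast hL
  have hcard : (0 : ℝ) < Fintype.card (Tor M) := by exact_mod_cast Fintype.card_pos
  have h₁ := effLaplacian_form_DeltaEff (L ^ k) M (Nat.one_le_pow k L (by omega)) (aK_pos ha hL1 hk) hm φ
  rw [← abs_of_pos hcard, ← abs_mul, mul_sub, h₁, hf φ, ← Finset.sum_sub_distrib]
  refine (Finset.abs_sum_le_sum_abs _ _).trans (le_of_eq (Finset.sum_congr rfl fun q _ => ?_))
  rw [← sub_mul, abs_mul, abs_of_nonneg (by positivity : (0 : ℝ) ≤ ‖ft M φ q‖ ^ 2)]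

end Summit.QuantumFields.YangMills.Theorems.TwoCutoffOperatorHeightFreeForm

end
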